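import Summits.BirchSwinnertonDyer.BirchSwinnertonDyer.Theorems.PrintX11aGamma0NonExtension
import Literature.NumberTheory.EllipticCurves.Gamma0AwayCharacterExtensionProofs
import HarnessLib

/-!
# Crux `X11aLowerHalf` (item stmt-BirchSwinnertonDyer-19064), stub `stub_muAnSurjDeepFive` side — IHARA'S LEMMA mod `p`
# in GROUP FORM, fact-free: a parabolic-trivial character of `Γ₀(tL′)` with finite image that is DOUBLY `t`-OLD is Eisenstein

Cell `bsd-print-x11a`, width seat bsd-line-x11a-p1-w2 g4 (`--supports stmt-BirchSwinnertonDyer-19064`).  BSD is not proved by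
any of this; nothing is asserted about any curve; PARTITION 0.  Pure group theory; third file of the set
`PrintX11aGamma0ParabolicCongruence` (Lemma E) → `PrintX11aGamma0NonExtension` (NonExtension) → this one.

* `gamma0Away_twoCharacter_extension` — **the Bass–Serre amalgam for a PAIR of characters** (the tree's
  `gamma0Away_character_extension_of_shiftInvariant_holds`, cell bsd-f2-manin, is the diagonal case `u″ = u` with additive
  field values): `t` prime, `t ∤ L′`, `F` ANY group, `u, u″ : Γ₀(L′) → F` homomorphisms with
  `u″(diag(t,1) γ diag(t,1)⁻¹) = u(γ)` for `γ ∈ Γ₀(L′t)` (compatibility on the EDGE group) ⟹ there is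
  `Φ : SL₂(ℤ[1/t]) → F`, multiplicative on `Δ = Γ₀(L′; ℤ[1/t])`, with `Φ ∘ ι = u`, `Φ ∘ θ ∘ ι = u″` (`θ = Ad(diag(t,1)⁻¹)`)
  and `Φ(ι c) = u(c)` on `Γ₀(L′t)`.  The proof is the tree's (Mathlib `Monoid.PushoutI` over `Bool`, the ping-pong of
  `Gamma0AwayPingPong.lean`, `Amalgam.exists_extension_of_pingPong`, generation `Gamma0Away.mem_of_apply_one_zero`) with the
  pair `(u, u″)` in place of `(u, u)` — the abstract ping-pong theorem already allows it.
* `iharaModP` — **Ihara's lemma mod `p`, group form** (bsd-idea-17's `FwSolenoid.IharaModP`, with the hypothesis `t ∤ L′`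
  that the amalgam needs): `F` FINITE, `χ : Γ₀(L′t) → F` killing the trace-`±2` elements («type II»; cuspidal homology
  characters are such) and DOUBLY `t`-OLD — `χ = u ∘ π₁ = u″ ∘ π_t` for characters `u, u″` of `Γ₀(L′)` — kills `Γ₁(L′t)`
  («Eisenstein»).  Dually (`F = 𝔽_ℓ`, any `ℓ`, also `ℓ = t`): the kernel of `π₁^* ⊕ π_t^* : H¹(Γ₀(L′),𝔽_ℓ)² → H¹(Γ₀(L′t),𝔽_ℓ)`
  meets the parabolic-trivial classes only in Eisenstein classes — Ihara 1975 / Ribet 1984 Lemma 3.2 in group-cohomological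
  dress, here from Serre's congruence subgroup property (tree, proved) instead of the geometry of `J₀`.
* `iharaModP_left`, `iharaModP_right` — the two old components `u`, `u″` are themselves Eisenstein when parabolic-trivial.

Bearing on the crux: the ω⁰-mechanism `fw-solenoid` (crux idea on U5 = 20614; same Greenberg object as `stub_muAnSurjDeepFive`,
image-independent) = [algebraic half: NonExtension ⟺ this Ihara lemma] + [analytic half: recurrence of the Manin cocycle on
`p`-power cusps — OPEN].  After this file the algebraic half is entirely in the kernel; the stub stays OPEN.  beyond-print: no
(Ihara 1975, Ribet 1984; Serre 1970/Mennicke 1967; Kurth–Long 2008).  No summit statement is proved by this seat.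

References: [SerreTrees1980] Ch. I §4.1 Thm. 6, Ch. II §1.4 Thm. 3; [Ribet1984ICM] §4 Thm. 4.1 (Ihara's
lemma); [SerreSL2Congruence1970] §2.6; [KurthLong2008] Prop. 3.2.
-/

set_option linter.dupNamespace false
set_option autoImplicit false

noncomputable section

namespace Summit.BirchSwinnertonDyer.BirchSwinnertonDyer.Theorems.Gamma0Parabolic

open scoped MatrixGroups
open CongruenceSubgroup Monoid Matrix.SpecialLinearGroup
open Literature.NumberTheory.EllipticCurves Literature.NumberTheory.EllipticCurves.ModularForms
  Literature.NumberTheory.EllipticCurves.Gamma0Away Literature.GroupTheory.CombinatorialGroupTheory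
  Literature.NumberTheory.Automorphic.SL2Rel
open Summit.BirchSwinnertonDyer.BirchSwinnertonDyer.Theorems.ConjSpanGenAllLevels (Away iota Delta)

/-! ### §1 The amalgam for a pair of characters -/

/-- **Bass–Serre for a PAIR of characters of `Γ₀(L′)`** (`t` prime, `t ∤ L′`, any group `F`): if `u, u″ : Γ₀(L′) → F` agree on
the edge group `Γ₀(L′t)` along (inclusion, `γ ↦ diag(t,1) γ diag(t,1)⁻¹`), i.e. `u″(π_t γ) = u(π₁ γ)`, then some
`Φ : SL₂(ℤ[1/t]) → F` is multiplicative on `Δ = Γ₀(L′; ℤ[1/t])` and restricts to `u` on `ιΓ₀(L′)`, to `u″ ∘ Ad(diag(t,1))` on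
`θιΓ₀(L′) = diag(t,1)⁻¹ Γ₀(L′) diag(t,1)`, and to `u ∘ π₁` on `ιΓ₀(L′t)`.  (Universal property of
`Δ = Γ₀(L′) *_{Γ₀(L′t)} Γ₀(L′)′`; the tree's diagonal case is `gamma0Away_character_extension_of_shiftInvariant_holds`.)
[cite: SerreTrees1980, Ch. I §4.1 Thm. 6, Ch. II §1.4 Thm. 3] -/
theorem gamma0Away_twoCharacter_extension (t : ℕ) [Fact t.Prime] [NeZero t] (L' : ℕ) [NeZero L']
    (htL : ¬ t ∣ L') {F : Type*} [Group F] (u u'' : Gamma0 L' →* F)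
    (hcompat : ∀ γ : Gamma0 (L' * t),
      u'' (Gamma0.degeneracyConj L' (L' * t) t dvd_rfl γ) =
        u (Gamma0.degeneracyConj L' (L' * t) 1 (mul_dvd_mul_left L' (one_dvd t)) γ)) :
    ∃ Φ : SL(2, Localization.Away (t : ℤ)) → F,
      (∀ g : SL(2, Localization.Away (t : ℤ)),
          (∃ s : Localization.Away (t : ℤ), g 1 0 = (L' : Localization.Away (t : ℤ)) * s) →
        ∀ g' : SL(2, Localization.Away (t : ℤ)),
          (∃ s : Localization.Away (t : ℤ), g' 1 0 = (L' : Localization.Away (t : ℤ)) * s) →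
          Φ (g * g') = Φ g * Φ g') ∧
      (∀ γ : Gamma0 L',
        Φ (Matrix.SpecialLinearGroup.map (Int.castRingHom (Localization.Away (t : ℤ))) (γ : SL(2, ℤ))) = u γ) ∧
      (∀ γ : Gamma0 L',
        Φ (theta t (Matrix.SpecialLinearGroup.map (Int.castRingHom (Localization.Away (t : ℤ))) (γ : SL(2, ℤ)))) =
          u'' γ) ∧
      (∀ c : Gamma0 (L' * t),
        Φ (Matrix.SpecialLinearGroup.map (Int.castRingHom (Localization.Away (t : ℤ))) (c : SL(2, ℤ))) =
          u (Gamma0.degeneracyConj L' (L' * t) 1 (mul_dvd_mul_left L' (one_dvd t)) c)) := by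
  -- the amalgam data (verbatim from the tree's diagonal case)
  let φ : ∀ _ : Bool, Gamma0 (L' * t) →* Gamma0 L' := fun b =>
    cond b (Gamma0.degeneracyConj L' (L' * t) t dvd_rfl)
      (Gamma0.degeneracyConj L' (L' * t) 1 (mul_dvd_mul_left L' (one_dvd t)))
  have hφ : ∀ b, Function.Injective (φ b) := amalgamMaps_injective t L'
  let ιΓ : Gamma0 L' →* SL(2, Localization.Away (t : ℤ)) :=
    (Matrix.SpecialLinearGroup.map (Int.castRingHom (Localization.Away (t : ℤ)))).comp (Gamma0 L').subtype
  let ιΓ' : Gamma0 (L' * t) →* SL(2, Localization.Away (t : ℤ)) :=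
    (Matrix.SpecialLinearGroup.map (Int.castRingHom (Localization.Away (t : ℤ)))).comp
      (Gamma0 (L' * t)).subtype
  let f : ∀ _ : Bool, Gamma0 L' →* SL(2, Localization.Away (t : ℤ)) := fun b =>
    cond b ((theta t).comp ιΓ) ιΓ
  have hf : ∀ b, (f b).comp (φ b) = ιΓ' := by
    intro b
    cases b
    · ext γ : 1
      show Matrix.SpecialLinearGroup.map (Int.castRingHom (Localization.Away (t : ℤ)))
          ((Gamma0.degeneracyConj L' (L' * t) 1 (mul_dvd_mul_left L' (one_dvd t)) γ : Gamma0 L') : SL(2, ℤ))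
        = Matrix.SpecialLinearGroup.map (Int.castRingHom (Localization.Away (t : ℤ))) (γ : SL(2, ℤ))
      rw [Gamma0.coe_degeneracyConj_one]
    · ext γ : 1
      exact theta_map_degeneracyConj t L' γ
  let ψ : PushoutI φ →* SL(2, Localization.Away (t : ℤ)) := PushoutI.lift f ιΓ' hf
  have hψ_false : ∀ γ : Gamma0 L', ψ (PushoutI.of (φ := φ) false γ) =
      Matrix.SpecialLinearGroup.map (Int.castRingHom (Localization.Away (t : ℤ))) (γ : SL(2, ℤ)) :=
    fun γ => by simp [ψ, f, ιΓ]
  have hψ_true : ∀ γ : Gamma0 L', ψ (PushoutI.of (φ := φ) true γ) =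
      theta t (Matrix.SpecialLinearGroup.map (Int.castRingHom (Localization.Away (t : ℤ))) (γ : SL(2, ℤ))) :=
    fun γ => by simp [ψ, f, ιΓ]
  have hψ_base : ∀ c : Gamma0 (L' * t), ψ (PushoutI.base φ c) =
      Matrix.SpecialLinearGroup.map (Int.castRingHom (Localization.Away (t : ℤ))) (c : SL(2, ℤ)) :=
    fun c => by simp [ψ, ιΓ']
  -- the PAIR of characters
  let f' : ∀ _ : Bool, Gamma0 L' →* F := fun b => cond b u'' u
  have hf' : ∀ b, (f' b).comp (φ b) = u.comp (φ false) := by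
    intro b
    cases b
    · rfl
    · ext γ : 1
      simp only [MonoidHom.comp_apply, f', φ, cond_true, cond_false]
      exact hcompat γ
  -- the ping-pong hypotheses (verbatim)
  obtain ⟨Φ, hmul, hof, hbase⟩ := Amalgam.exists_extension_of_pingPong hφ ψ {g | TopHeavy t g} (height t)
    (fun γ => by
      rw [hψ_false]
      exact ⟨not_topHeavy_map t _, by rw [height_map, height_one]⟩)
    (fun γ hγ x hx => by
      rw [hψ_false]
      refine not_topHeavy_map_mul t _ (fun hd => hγ ?_) hx
      exact mem_range_inclusion_of_dvd t L' htL γ hd)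
    (fun γ hγ x hx => by
      rw [hψ_true]
      refine topHeavy_theta_map_mul t _ (fun hd => hγ ?_) hx
      exact mem_range_degeneracyConj_of_dvd t L' γ hd)
    (fun c x => by
      rw [hψ_base]
      refine topHeavy_map_mul_iff t _ ?_ x
      have hc := c.2
      rw [Gamma0_mem] at hc
      exact dvd_trans (by push_cast; exact dvd_mul_left _ _) ((ZMod.intCast_zmod_eq_zero_iff_dvd _ _).mp hc))
    (fun γ hγ => by
      rw [hψ_false] at hγ
      have := map_injective t (hγ.trans (map_one _).symm)
      exact Subtype.ext this)
    f' (u.comp (φ false)) hf'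
  -- generation: `Γ₀(L′; ℤ[1/t]) ⊆ ψ(P)`
  have hS : ∀ γ : SL(2, ℤ), γ ∈ Gamma0 L' →
      Matrix.SpecialLinearGroup.map (Int.castRingHom (Localization.Away (t : ℤ))) γ ∈ ψ.range :=
    fun γ hγ => ⟨PushoutI.of (φ := φ) false ⟨γ, hγ⟩, hψ_false ⟨γ, hγ⟩⟩
  have hS' : ∀ γ : SL(2, ℤ), γ ∈ Gamma0 L' →
      theta t (Matrix.SpecialLinearGroup.map (Int.castRingHom (Localization.Away (t : ℤ))) γ) ∈ ψ.range :=
    fun γ hγ => ⟨PushoutI.of (φ := φ) true ⟨γ, hγ⟩, hψ_true ⟨γ, hγ⟩⟩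
  refine ⟨Φ, ?_, ?_, ?_, ?_⟩
  · intro g hg g' hg'
    exact hmul g (mem_of_apply_one_zero t ψ.range hS hS' htL g hg) g'
      (mem_of_apply_one_zero t ψ.range hS hS' htL g' hg')
  · intro γ
    have := hof false γ
    rw [hψ_false] at this
    exact this
  · intro γ
    have := hof true γ
    rw [hψ_true] at this
    exact this
  · intro c
    have := hbase c
    rw [hψ_base] at this
    exact this

/-! ### §2 Ihara's lemma mod `p`, group form -/

/-- **IHARA'S LEMMA mod `p` (group form; bsd-idea-17's `FwSolenoid.IharaModP` with `t ∤ L′`).**  Let `t` be prime, `t ∤ L′`,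
`F` a FINITE group and `χ : Γ₀(L′t) → F` a homomorphism killing every element of trace `±2` («type II» — e.g. a cuspidal
mod-`ℓ` homology character of `X₀(L′t)`).  If `χ` is DOUBLY `t`-OLD — `χ = u ∘ π₁ = u″ ∘ π_t` for homomorphisms
`u, u″ : Γ₀(L′) → F` (`π₁` the inclusion, `π_t γ = diag(t,1) γ diag(t,1)⁻¹`) — then `χ` kills `Γ₁(L′t)` (is Eisenstein).
Proof: the pair `(u, u″)` glues to the amalgam `Γ₀(L′; ℤ[1/t])` (`gamma0Away_twoCharacter_extension`), and a character of
`Γ₀(L′t)` with finite image that extends there is Eisenstein (`map_eq_one_of_traceTwo_of_extends`: Serre's congruence subgroup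
property + Lemma E).  [cite: Ribet1984ICM, §4 Thm. 4.1 (Ihara's lemma)]
[cite: SerreSL2Congruence1970, §2.6 Thm. 2 (b), Cor. 3] [cite: KurthLong2008, Prop. 3.2] -/
theorem iharaModP (t : ℕ) [Fact t.Prime] [NeZero t] (L' : ℕ) [NeZero L'] (htL : ¬ t ∣ L')
    {F : Type*} [Group F] [Finite F] (χ : Gamma0 (L' * t) →* F)
    (htr : ∀ γ : Gamma0 (L' * t),
      ((γ : SL(2, ℤ)) 0 0 + (γ : SL(2, ℤ)) 1 1 = 2 ∨ (γ : SL(2, ℤ)) 0 0 + (γ : SL(2, ℤ)) 1 1 = -2) → χ γ = 1)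
    (u u'' : Gamma0 L' →* F)
    (hu : ∀ γ : Gamma0 (L' * t), u (Gamma0.degeneracyConj L' (L' * t) 1 (mul_dvd_mul_left L' (one_dvd t)) γ) = χ γ)
    (hu'' : ∀ γ : Gamma0 (L' * t), u'' (Gamma0.degeneracyConj L' (L' * t) t dvd_rfl γ) = χ γ) :
    ∀ γ ∈ Gamma1' (L' * t), χ γ = 1 := by
  obtain ⟨Φ, hmul, -, -, hbase⟩ := gamma0Away_twoCharacter_extension t L' htL u u''
    (fun γ => by rw [hu'' γ, hu γ])
  refine map_eq_one_of_parabolic_of_extends (m := t) (M := L') (N := L' * t)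
    (Fact.out : t.Prime).two_le (Nat.pos_of_ne_zero (NeZero.ne L')) χ
    (fun γ hγ => htr γ (Or.inl ?_)) Φ ?_ ?_
  · rcases hγ with h | h <;> rw [h] <;> norm_num
  · intro g hg g' hg'
    exact hmul g hg g' hg'
  · intro γ
    rw [← hu γ]
    exact hbase γ

/-- **The first old component is Eisenstein**: under the hypotheses of the amalgam (`t` prime, `t ∤ L′`, `u, u″` compatible on
`Γ₀(L′t)`, `F` finite), if `u` kills the trace-`±2` elements of `Γ₀(L′)` then `u` kills `Γ₁(L′)`.
[cite: Ribet1984ICM, §4 Thm. 4.1] [cite: SerreSL2Congruence1970, §2.6 Thm. 2 (b), Cor. 3] [cite: KurthLong2008, Prop. 3.2] -/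
theorem iharaModP_left (t : ℕ) [Fact t.Prime] [NeZero t] (L' : ℕ) [NeZero L'] (htL : ¬ t ∣ L')
    {F : Type*} [Group F] [Finite F] (u u'' : Gamma0 L' →* F)
    (hcompat : ∀ γ : Gamma0 (L' * t),
      u'' (Gamma0.degeneracyConj L' (L' * t) t dvd_rfl γ) =
        u (Gamma0.degeneracyConj L' (L' * t) 1 (mul_dvd_mul_left L' (one_dvd t)) γ))
    (htr : ∀ γ : Gamma0 L',
      ((γ : SL(2, ℤ)) 0 0 + (γ : SL(2, ℤ)) 1 1 = 2 ∨ (γ : SL(2, ℤ)) 0 0 + (γ : SL(2, ℤ)) 1 1 = -2) → u γ = 1) :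
    ∀ γ ∈ Gamma1' L', u γ = 1 := by
  obtain ⟨Φ, hmul, hofu, -, -⟩ := gamma0Away_twoCharacter_extension t L' htL u u'' hcompat
  refine map_eq_one_of_parabolic_of_extends (m := t) (M := L') (N := L')
    (Fact.out : t.Prime).two_le (Nat.pos_of_ne_zero (NeZero.ne L')) u
    (fun γ hγ => htr γ (Or.inl ?_)) Φ (fun g hg g' hg' => hmul g hg g' hg') hofu
  rcases hγ with h | h <;> rw [h] <;> norm_num

/-- `θ = Ad(diag(t,1)⁻¹)` preserves `Δ = Γ₀(L′; ℤ[1/t])` (the lower-left entry is multiplied by `t`). [cite: SerreTrees1980, Ch. II §1.4] -/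
theorem theta_mem_delta (t L' : ℕ) {g : SL(2, Localization.Away (t : ℤ))}
    (hg : ∃ s : Localization.Away (t : ℤ), g 1 0 = (L' : Localization.Away (t : ℤ)) * s) :
    ∃ s : Localization.Away (t : ℤ), (theta t g) 1 0 = (L' : Localization.Away (t : ℤ)) * s := by
  obtain ⟨s, hs⟩ := hg
  refine ⟨(t : Localization.Away (t : ℤ)) * s, ?_⟩
  show (t : Localization.Away (t : ℤ)) * g 1 0 = _
  rw [hs]; ring

/-- **The second old component is Eisenstein**: symmetrically, if `u″` kills the trace-`±2` elements of `Γ₀(L′)` then `u″`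
kills `Γ₁(L′)` (extend by `Φ ∘ θ`, `θ(Δ) = Δ`).
[cite: Ribet1984ICM, §4 Thm. 4.1] [cite: SerreSL2Congruence1970, §2.6 Thm. 2 (b), Cor. 3] [cite: KurthLong2008, Prop. 3.2] -/
theorem iharaModP_right (t : ℕ) [Fact t.Prime] [NeZero t] (L' : ℕ) [NeZero L'] (htL : ¬ t ∣ L')
    {F : Type*} [Group F] [Finite F] (u u'' : Gamma0 L' →* F)
    (hcompat : ∀ γ : Gamma0 (L' * t),
      u'' (Gamma0.degeneracyConj L' (L' * t) t dvd_rfl γ) =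
        u (Gamma0.degeneracyConj L' (L' * t) 1 (mul_dvd_mul_left L' (one_dvd t)) γ))
    (htr : ∀ γ : Gamma0 L',
      ((γ : SL(2, ℤ)) 0 0 + (γ : SL(2, ℤ)) 1 1 = 2 ∨ (γ : SL(2, ℤ)) 0 0 + (γ : SL(2, ℤ)) 1 1 = -2) → u'' γ = 1) :
    ∀ γ ∈ Gamma1' L', u'' γ = 1 := by
  obtain ⟨Φ, hmul, -, hofu'', -⟩ := gamma0Away_twoCharacter_extension t L' htL u u'' hcompat
  refine map_eq_one_of_parabolic_of_extends (m := t) (M := L') (N := L')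
    (Fact.out : t.Prime).two_le (Nat.pos_of_ne_zero (NeZero.ne L')) u''
    (fun γ hγ => htr γ (Or.inl ?_)) (fun g => Φ (theta t g)) ?_ hofu''
  · rcases hγ with h | h <;> rw [h] <;> norm_num
  · intro g hg g' hg'
    show Φ (theta t (g * g')) = Φ (theta t g) * Φ (theta t g')
    rw [map_mul]
    exact hmul _ (theta_mem_delta t L' hg) _ (theta_mem_delta t L' hg')

end Summit.BirchSwinnertonDyer.BirchSwinnertonDyer.Theorems.Gamma0Parabolic

end
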